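import Literature.IUT.HodgeTheaters.GlobalFrobenioidsCoricRigidityOfOrdHom
import HarnessLib

/-!
# [IUTchI] Example 5.1 (v), pp. 127–128: the ∞κ- and ∞κ×-uniqueness at the genuine Kummer container over the
# CANONICAL levels — "`H` ranges over the open subgroups of `π₁^rat(†𝒟^⊛)`" (proof-only)

S. Mochizuki, *Inter-universal Teichmüller theory I*, kurims manuscript (May 2020), §5 Example 5.1 (v), p. 127
l. 57–62 ([IUTchI] Ex 5.1 (v) p.127) [claim: Mochizuki2012, status: disputed]: "by considering the Kummer classes
⊆ `lim_{→ H} H¹(H, μ_Ẑ(†𝕄^⊛_∞κ))` … where `H` ranges over the open subgroups of `π₁^rat(†𝒟^⊛)`"; p. 128 l. 49–54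
(the boxed uniqueness).  LANA §6.1 pp. 31–32 [LANA2026Report] ("`H` var[ies] over an inductive system of (open)
subgroups of `G`").  Classical: a profinite group has a neighbourhood basis of `1` of open normal subgroups, each of
finite index [RibesZalesskii2010, Thm 2.1.3].

Sub-DAG `plan/L5/SUBDAG-IUTchI-Ex51.md` rows E51/L25 (the container), L29; GAP-LEDGER G-w4d056-2; node IUTchI:Ex5.1(v).
PROOF-ONLY: no definition, no instance, no new `Prop` fact.

**State before this file.**  abc-iut-w4-d056's closers `existsUniqueCoricStructure_infκPair_of_ordHom_of_fixedRoots`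
/ `…_infκxPair_…` (p435414) are stated for an ARBITRARY directed exhaustive system `S` of normal finite-index
subgroups of `π₁^rat` — six "system" binders (`S`, `hS`, normality, finite index, exhaustion, the index order).

**What this file proves.**  The system of print — ALL open normal subgroups of the profinite group `π₁^rat(†𝒟^⊛)`
(Mathlib `OpenNormalSubgroup`, ordered by reverse inclusion) — IS such a system: directed (intersections), each
member normal and of finite index (open in a compact group, `Subgroup.quotient_finite_of_isOpen`), and EXHAUSTIVE
on `K_rat^×` because the stabilisers of rational functions are open (abc-iut-L5-t1's field `isOpen_stabilizer_krat`;
`ProfiniteGrp.exist_openNormalSubgroup_sub_open_nhds_of_one`).  Hence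
**`NFBridgeRecon.existsUniqueCoricStructure_infκPair_canonical`** / **`…_infκxPair_canonical`**: the boxed
uniqueness of Ex. 5.1 (v) for BOTH pairs with the genuine Kummer container over the canonical levels, whose only
hypotheses are: `hcoe` (units action = field action), `K_rat^×` rootable with all roots of unity, `1 ∈ M` and
`f ∈ M ⇔ fⁿ ∈ M` (Rmk 3.1.7 (ii) "divisible"), (iv) `hdiv` — no unit other than `1` fixed by an open normal subgroup
`H` has `H`-fixed roots of all orders (E51/L26; Kummer theory of the finite levels), (o) `hordmul` — `ord_x` is
additive on `π₁^rat`-fixed nonzero rational functions, and Rmk 3.1.7 (i)/(ii) `hpole`/`hex`.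
No side is taken on [IUTchIII] Cor. 3.12; nothing of the disputed series is asserted; typed ≠ proved.
-/

namespace Literature.IUT.HodgeTheaters

open ProfiniteGrp ProfiniteGrp.ProfiniteCompletion
open Literature.AnabelianGeometry.EtaleTheta Literature.AnabelianGeometry.EtaleTheta.ZHatLevel

namespace NFBridgeRecon

variable (N : NFBridgeRecon.{0}) [MulDistribMulAction N.piRat N.Kratˣ] [RootableBy N.Kratˣ ℕ]

/-! ### The canonical level system: all open normal subgroups of `π₁^rat(†𝒟^⊛)` -/

omit [MulDistribMulAction N.piRat N.Kratˣ] [RootableBy N.Kratˣ ℕ] in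
/-- The open normal subgroups of `π₁^rat(†𝒟^⊛)`, indexed by reverse inclusion, form an antitone family of
subgroups. ([IUTchI] Ex 5.1 (v) p.127) [claim: Mochizuki2012, status: disputed] -/
theorem openNormal_antitone :
    ∀ ⦃i j : (OpenNormalSubgroup N.piRat)ᵒᵈ⦄, i ≤ j →
      ((OrderDual.ofDual j : OpenNormalSubgroup N.piRat) : Subgroup N.piRat) ≤
        ((OrderDual.ofDual i : OpenNormalSubgroup N.piRat) : Subgroup N.piRat) :=
  fun _ _ hij _ hx => OrderDual.ofDual_le_ofDual.mpr hij hx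

omit [MulDistribMulAction N.piRat N.Kratˣ] [RootableBy N.Kratˣ ℕ] in
/-- Every open normal subgroup of the profinite group `π₁^rat(†𝒟^⊛)` has finite index (open in a compact group).
[cite: RibesZalesskii2010, Thm 2.1.3] -/
theorem openNormal_finiteIndex (i : (OpenNormalSubgroup N.piRat)ᵒᵈ) :
    ((OrderDual.ofDual i : OpenNormalSubgroup N.piRat) : Subgroup N.piRat).FiniteIndex := by
  haveI : Finite (N.piRat ⧸ ((OrderDual.ofDual i : OpenNormalSubgroup N.piRat) : Subgroup N.piRat)) :=
    Subgroup.quotient_finite_of_isOpen _ (OrderDual.ofDual i).isOpen'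
  exact Subgroup.finiteIndex_of_finite_quotient

omit [RootableBy N.Kratˣ ℕ] in
/-- **EXHAUSTION**: every nonzero rational function is fixed by some open normal subgroup of `π₁^rat(†𝒟^⊛)` — its
stabiliser is open (smoothness of the action, Ex. 5.1 (i)) and open neighbourhoods of `1` in a profinite group
contain open normal subgroups.  So `K_rat^× = ⋃_H (K_rat^×)^H` over the canonical levels (LANA §6.1 hypothesis (c)).
([IUTchI] Ex 5.1 (v) p.127) [claim: Mochizuki2012, status: disputed] -/
theorem isExhausted_openNormal
    (hcoe : ∀ (g : N.piRat) (a : N.Kratˣ), ((g • a : N.Kratˣ) : N.Krat) = g • (a : N.Krat)) :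
    IsExhausted N.Kratˣ
      (fun i : (OpenNormalSubgroup N.piRat)ᵒᵈ => ((OrderDual.ofDual i : OpenNormalSubgroup N.piRat) : Subgroup N.piRat)) := by
  intro a
  obtain ⟨H, hH⟩ := ProfiniteGrp.exist_openNormalSubgroup_sub_open_nhds_of_one
    (N.isOpen_stabilizer_krat (a : N.Krat)) (MulAction.mem_stabilizer_iff.mpr (one_smul _ _))
  refine ⟨OrderDual.toDual H, fun γ => Units.ext ?_⟩
  have hγ : ((γ : N.piRat) : N.piRat) ∈ MulAction.stabilizer N.piRat (a : N.Krat) := hH γ.2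
  rw [show ((γ • a : N.Kratˣ) : N.Krat) = (((γ : N.piRat) • a : N.Kratˣ) : N.Krat) from rfl, hcoe]
  exact MulAction.mem_stabilizer_iff.mp hγ

/-! ### Ex. 5.1 (v) uniqueness over the canonical levels -/

/-- **[IUTchI] Ex. 5.1 (v), ∞κ, at the genuine Kummer container `lim_{→ H} H¹(H, Λ K_rat^×)` over ALL OPEN NORMAL
SUBGROUPS `H` of `π₁^rat(†𝒟^⊛)`** ("where `H` ranges over the open subgroups of `π₁^rat(†𝒟^⊛)`", p. 127):
`ExistsUniqueCoricStructure π₁^rat 𝕄^⊛_∞κ(†𝒟^⊚)` from `hcoe`, rootability and roots of unity of `K_rat`,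
`1 ∈ 𝕄^⊛_∞κ`, `f ∈ 𝕄^⊛_∞κ ⇔ fⁿ ∈ 𝕄^⊛_∞κ`, (iv) `hdiv`, (o) `hordmul`, and Rmk 3.1.7 (i)/(ii) `hpole`/`hex` — the six
system binders of `…_of_ordHom_of_fixedRoots` DISCHARGED.  PROVED. ([IUTchI] Ex 5.1 (v) p.128)
[claim: Mochizuki2012, status: disputed] -/
theorem existsUniqueCoricStructure_infκPair_canonical
    (hcoe : ∀ (g : N.piRat) (a : N.Kratˣ), ((g • a : N.Kratˣ) : N.Krat) = g • (a : N.Krat))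
    (hprim : ∀ n : ℕ, 0 < n → ∃ ζ : N.Krat, IsPrimitiveRoot ζ n)
    (h1 : (1 : N.Krat) ∈ N.Minfκ) (hpow : ∀ (f : N.Krat) (n : ℕ), 0 < n → (f ∈ N.Minfκ ↔ f ^ n ∈ N.Minfκ))
    (hdiv : ∀ (H : OpenNormalSubgroup N.piRat) (a : N.Kratˣ), a ∈ invariants (A := N.Kratˣ) (H : Subgroup N.piRat) →
      (∀ n : ℕ+, ∃ b ∈ invariants (A := N.Kratˣ) (H : Subgroup N.piRat), b ^ (n : ℕ) = a) → a = 1)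
    {X : Type*} (ord : X → N.Krat → ℤ)
    (hordmul : ∀ (x : X) (a b : N.Krat), a ≠ 0 → b ≠ 0 → (∀ g : N.piRat, g • a = a) → (∀ g : N.piRat, g • b = b) →
      ord x (a * b) = ord x a + ord x b)
    (hpole : ∀ f' ∈ N.Minfκ, (∀ g : N.piRat, g • f' = f') →
      ∀ x₁ x₂ : X, x₁ ≠ x₂ → ¬ (ord x₁ f' < 0 ∧ ord x₂ f' < 0))
    (hex : ∃ f ∈ N.Minfκ, (∀ g : N.piRat, g • f = f) ∧
      ∃ x₁ x₂ : X, x₁ ≠ x₂ ∧ 0 < ord x₁ f ∧ 0 < ord x₂ f) :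
    ExistsUniqueCoricStructure N.piRat N.infκPair := by
  classical
  haveI : Nonempty (OpenNormalSubgroup N.piRat)ᵒᵈ :=
    ⟨OrderDual.toDual { toOpenSubgroup := ⊤, isNormal' := Subgroup.normal_of_characteristic ⊤ }⟩
  exact N.existsUniqueCoricStructure_infκPair_of_ordHom_of_fixedRoots
    (fun i : (OpenNormalSubgroup N.piRat)ᵒᵈ => ((OrderDual.ofDual i : OpenNormalSubgroup N.piRat) : Subgroup N.piRat))
    N.openNormal_antitone hcoe hprim (N.isExhausted_openNormal hcoe) N.openNormal_finiteIndex h1 hpow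
    (fun i a => hdiv (OrderDual.ofDual i) a) ord hordmul hpole hex

/-- **[IUTchI] Ex. 5.1 (v), "respectively, ∞κ×", over ALL OPEN NORMAL SUBGROUPS of `π₁^rat(†𝒟^⊛)`**:
`ExistsUniqueCoricStructure π₁^rat 𝕄^⊛_∞κ×(†𝒟^⊚)` from the same primitive hypotheses on `𝕄^⊛_∞κ×`.  PROVED.
([IUTchI] Ex 5.1 (v) p.128) [claim: Mochizuki2012, status: disputed] -/
theorem existsUniqueCoricStructure_infκxPair_canonical
    (hcoe : ∀ (g : N.piRat) (a : N.Kratˣ), ((g • a : N.Kratˣ) : N.Krat) = g • (a : N.Krat))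
    (hprim : ∀ n : ℕ, 0 < n → ∃ ζ : N.Krat, IsPrimitiveRoot ζ n)
    (h1 : (1 : N.Krat) ∈ N.Minfκx) (hpow : ∀ (f : N.Krat) (n : ℕ), 0 < n → (f ∈ N.Minfκx ↔ f ^ n ∈ N.Minfκx))
    (hdiv : ∀ (H : OpenNormalSubgroup N.piRat) (a : N.Kratˣ), a ∈ invariants (A := N.Kratˣ) (H : Subgroup N.piRat) →
      (∀ n : ℕ+, ∃ b ∈ invariants (A := N.Kratˣ) (H : Subgroup N.piRat), b ^ (n : ℕ) = a) → a = 1)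
    {X : Type*} (ord : X → N.Krat → ℤ)
    (hordmul : ∀ (x : X) (a b : N.Krat), a ≠ 0 → b ≠ 0 → (∀ g : N.piRat, g • a = a) → (∀ g : N.piRat, g • b = b) →
      ord x (a * b) = ord x a + ord x b)
    (hpole : ∀ f' ∈ N.Minfκx, (∀ g : N.piRat, g • f' = f') →
      ∀ x₁ x₂ : X, x₁ ≠ x₂ → ¬ (ord x₁ f' < 0 ∧ ord x₂ f' < 0))
    (hex : ∃ f ∈ N.Minfκx, (∀ g : N.piRat, g • f = f) ∧
      ∃ x₁ x₂ : X, x₁ ≠ x₂ ∧ 0 < ord x₁ f ∧ 0 < ord x₂ f) :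
    ExistsUniqueCoricStructure N.piRat N.infκxPair := by
  classical
  haveI : Nonempty (OpenNormalSubgroup N.piRat)ᵒᵈ :=
    ⟨OrderDual.toDual { toOpenSubgroup := ⊤, isNormal' := Subgroup.normal_of_characteristic ⊤ }⟩
  exact N.existsUniqueCoricStructure_infκxPair_of_ordHom_of_fixedRoots
    (fun i : (OpenNormalSubgroup N.piRat)ᵒᵈ => ((OrderDual.ofDual i : OpenNormalSubgroup N.piRat) : Subgroup N.piRat))
    N.openNormal_antitone hcoe hprim (N.isExhausted_openNormal hcoe) N.openNormal_finiteIndex h1 hpow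
    (fun i a => hdiv (OrderDual.ofDual i) a) ord hordmul hpole hex

end NFBridgeRecon

end Literature.IUT.HodgeTheaters
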